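import Summits.AtomisticToContinuum.FouriersLaw.Theses.PhononMeanFreePath
import Summits.AtomisticToContinuum.FouriersLaw.Theorems.ConductanceLowerBound.Negative.GammaZeroNonUniqueness

/-!
# `BoundaryKubo` — load-bearing hypotheses, refutation shape, reformulations and reflection
symmetry (negative-side support)

Support lemmas for crux `PhononMeanFreePath.BoundaryKubo` (item stmt-AtomisticToContinuum-11812,
the fixed-`N` cross-form boundary Kubo identity `D_{N+1} = N(γ²/T²)∫₀^∞ Cov_T(p_0², K_t p_N²)`)
from the standing disprover's work file `Cruxes/BoundaryKubo/Disproof.lean` §0–6, all sorry-free.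
Nothing here closes the item; no Theses statement is asserted.

* §0 read-back (`boundaryKubo_iff`, `Iff.rfl`) in terms of `kuboIntegrand`, `kuboValue`,
  `LimitClause`, `UniqueSteady` (= `NessUnique` at a point, `nessUnique_iff`), `SteadyFamily`.
* §1 `N = 0` is harmless: the one-site chain has no bond (`totalCurrent_one_site`), the claimed
  value is `0` (`kuboValue_zero`), the limit clause holds for every family (`limitClause_zero`).
* §2 the limit clause is not a tautology in the family: Dirac junk families break it
  (`limitClause_false_without_steady`), and for `T ≤ 0` even steady families do
  (`limitClause_false_without_T_pos`) — stationarity and `T > 0` are load-bearing.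
* §3 shape of any refutation (`not_boundaryKubo_iff`): it must PROVE weak-NESS uniqueness
  (item 0741) at an admissible parameter point and break a clause there.
* §4 under the hypotheses `μ (N+1) T T` is the Gibbs state, its current vanishes, and the limit
  clause is exactly `HasDerivAt` of the steady current at `δ = 0` (`limitClause_iff_hasDerivAt`).
* §5 `γ = 0`: the class `IsSteadyState` is temperature-blind, uniqueness fails
  (`pinnedChain_not_unique_gamma_zero`, landed for crux 11749, reused), so the body of the crux is
  vacuous at `γ = 0` (`body_vacuous_gamma_zero`): `0 < γ` enters a proof only through
  uniqueness / mixing.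
* (§6, reflection symmetry and the one-sided form of the limit clause, is the companion file
  `Negative/Reflection.lean`.)
-/

noncomputable section

namespace Summit.AtomisticToContinuum.FouriersLaw.Theorems.BoundaryKubo.Negative.LoadBearing

open MeasureTheory Filter Topology Set
open Literature.MathematicalPhysics.KineticTheory.HeatConduction
open Summit.AtomisticToContinuum.FouriersLaw.Theses.PhononMeanFreePath (BoundaryKubo NessUnique)

/-! ### §0 Read-back of the crux -/

/-- The Kubo integrand `C_N(t) = Cov_{Gibbs_T}(p_0², K_t p_N²)` of the `(N+1)`-site chain at
temperature `T` (verbatim sub-term of the crux). [folklore] -/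
def kuboIntegrand (ω₂ lam β γ T : ℝ) (N : ℕ) (t : ℝ) : ℝ :=
  (∫ z, (z.2 0) ^ 2 * (∫ y, (y.2 (Fin.last N)) ^ 2
      ∂((pinnedChain ω₂ lam β γ).transitionKernel (N + 1) T T t.toNNReal z))
      ∂((pinnedChain ω₂ lam β γ).gibbsMeasure (N + 1) T)) -
    (∫ z, (z.2 0) ^ 2 ∂((pinnedChain ω₂ lam β γ).gibbsMeasure (N + 1) T)) *
      (∫ z, (∫ y, (y.2 (Fin.last N)) ^ 2
        ∂((pinnedChain ω₂ lam β γ).transitionKernel (N + 1) T T t.toNNReal z))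
        ∂((pinnedChain ω₂ lam β γ).gibbsMeasure (N + 1) T))

/-- The claimed response coefficient `D_{N+1} = N · (γ²/T²) · ∫₀^∞ C_N`. [folklore] -/
def kuboValue (ω₂ lam β γ T : ℝ) (N : ℕ) : ℝ :=
  (N : ℝ) * (γ ^ 2 / T ^ 2) * ∫ t in Ioi (0 : ℝ), kuboIntegrand ω₂ lam β γ T N t

/-- The limit clause of the crux for the family `μ` at `(T, N)`:
`totalCurrent(μ (N+1) (T+δ/2) (T-δ/2))/δ → kuboValue` as `δ → 0`, `δ ≠ 0`. [folklore] -/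
def LimitClause (ω₂ lam β γ : ℝ) (μ : (M : ℕ) → ℝ → ℝ → Measure (PhaseSpace M)) (T : ℝ)
    (N : ℕ) : Prop :=
  Tendsto (fun δ : ℝ =>
      (pinnedChain ω₂ lam β γ).totalCurrent (μ (N + 1) (T + δ / 2) (T - δ / 2)) / δ)
    (𝓝[≠] 0) (𝓝 (kuboValue ω₂ lam β γ T N))

/-- Weak-NESS uniqueness at one parameter point (the hypothesis of the crux = route item
`NessUnique` specialised, `nessUnique_iff`). [folklore] -/
def UniqueSteady (ω₂ lam β γ : ℝ) : Prop :=
  ∀ (N : ℕ) (T_L T_R : ℝ), 0 < T_L → 0 < T_R → ∀ μ ν : Measure (PhaseSpace N),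
    (pinnedChain ω₂ lam β γ).IsSteadyState N T_L T_R μ →
      (pinnedChain ω₂ lam β γ).IsSteadyState N T_L T_R ν → μ = ν

/-- `μ` is a family of weak steady states at all positive bath temperatures. [folklore] -/
def SteadyFamily (ω₂ lam β γ : ℝ) (μ : (M : ℕ) → ℝ → ℝ → Measure (PhaseSpace M)) : Prop :=
  ∀ (N : ℕ) (T_L T_R : ℝ), 0 < T_L → 0 < T_R →
    (pinnedChain ω₂ lam β γ).IsSteadyState N T_L T_R (μ N T_L T_R)

/-- Read-back: the crux is literally the statement assembled from the pieces above. [folklore] -/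
theorem boundaryKubo_iff :
    BoundaryKubo ↔ ∀ ω₂ lam β γ : ℝ, 0 < ω₂ → 0 < lam → 0 < β → 0 < γ →
      UniqueSteady ω₂ lam β γ →
        ∀ μ : (M : ℕ) → ℝ → ℝ → Measure (PhaseSpace M), SteadyFamily ω₂ lam β γ μ →
          ∀ T : ℝ, 0 < T → ∀ N : ℕ,
            IntegrableOn (kuboIntegrand ω₂ lam β γ T N) (Ioi 0) ∧ LimitClause ω₂ lam β γ μ T N :=
  Iff.rfl

/-- The route's support item `NessUnique` is `UniqueSteady` at every admissible point. [folklore] -/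
theorem nessUnique_iff :
    NessUnique ↔ ∀ ω₂ lam β γ : ℝ, 0 < ω₂ → 0 < lam → 0 < β → 0 < γ → UniqueSteady ω₂ lam β γ :=
  Iff.rfl

/-! ### §1 `N = 0`: the one-site chain is not an attack surface -/

/-- A one-site chain has no bond: its total current vanishes for EVERY measure. [folklore] -/
theorem totalCurrent_one_site (P : OscillatorChain) (μ : Measure (PhaseSpace 1)) :
    P.totalCurrent μ = 0 := by
  simp [OscillatorChain.totalCurrent, OscillatorChain.bondCurrent]

/-- … and the claimed value at `N = 0` is `0 · (γ²/T²) · ∫ C_0 = 0`. [folklore] -/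
theorem kuboValue_zero (ω₂ lam β γ T : ℝ) : kuboValue ω₂ lam β γ T 0 = 0 := by
  simp [kuboValue]

/-- Hence the limit clause at `N = 0` holds for every family whatsoever (steady or not): the
`N = 0` instance of the crux reduces to `C_0 ∈ L¹(0,∞)`. [folklore] -/
theorem limitClause_zero (ω₂ lam β γ T : ℝ) (μ : (M : ℕ) → ℝ → ℝ → Measure (PhaseSpace M)) :
    LimitClause ω₂ lam β γ μ T 0 := by
  unfold LimitClause
  simp only [totalCurrent_one_site, zero_div, kuboValue_zero]
  exact tendsto_const_nhds

/-! ### §2 The limit clause is not a tautology: Dirac junk families -/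

/-- The phase point `q_i = i`, `p_i = 1`: every bond is stretched by `1` and carries the current
`j_i = -(p_i + p_{i+1})/2 · V'(1) = -(1 + β)`. [folklore] -/
def junkPoint (M : ℕ) : PhaseSpace M := (fun i => (i.val : ℝ), fun _ => 1)

/-- The two-site chain at `junkPoint` carries total current `-(1 + β)`. [folklore] -/
theorem totalCurrent_dirac_junkPoint (ω₂ lam β γ : ℝ) :
    (pinnedChain ω₂ lam β γ).totalCurrent (Measure.dirac (junkPoint 2)) = -(1 + β) := by
  simp [OscillatorChain.totalCurrent, OscillatorChain.bondCurrent, integral_dirac, junkPoint,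
    Fin.sum_univ_two, pinnedChain_deriv_V]

/-- `c/δ` (`c ≠ 0`) has no finite limit at `δ → 0`: a function eventually equal to it along
`𝓝[≠] 0` does not converge. [folklore] -/
theorem not_tendsto_of_eventuallyEq_const_div {f : ℝ → ℝ} {c L : ℝ} (hc : c ≠ 0)
    (hf : f =ᶠ[𝓝[≠] (0 : ℝ)] fun δ => c / δ) : ¬ Tendsto f (𝓝[≠] 0) (𝓝 L) := by
  intro h
  have hid : Tendsto (fun δ : ℝ => δ) (𝓝[≠] (0 : ℝ)) (𝓝 0) :=
    tendsto_nhdsWithin_of_tendsto_nhds tendsto_id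
  have h1 : Tendsto (fun δ : ℝ => f δ * δ) (𝓝[≠] 0) (𝓝 (L * 0)) := h.mul hid
  have h2 : (fun δ : ℝ => f δ * δ) =ᶠ[𝓝[≠] (0 : ℝ)] fun _ => c := by
    filter_upwards [hf, self_mem_nhdsWithin] with δ hδ hne
    rw [hδ, div_mul_cancel₀ c (Set.mem_compl_singleton_iff.mp hne)]
  have h3 : Tendsto (fun _ : ℝ => c) (𝓝[≠] (0 : ℝ)) (𝓝 (L * 0)) := h1.congr' h2
  rw [mul_zero] at h3
  exact hc (tendsto_nhds_unique h3 tendsto_const_nhds ▸ rfl)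

/-- **Stationarity is load-bearing.** Without the steady-state hypothesis on the family the limit
clause fails (any `β ≥ 0`, any other parameters): for the Dirac family at `junkPoint`,
`totalCurrent/δ = -(1+β)/δ` diverges. [folklore] -/
theorem limitClause_false_without_steady (ω₂ lam γ T : ℝ) {β : ℝ} (hβ : 0 ≤ β) :
    ¬ ∀ μ : (M : ℕ) → ℝ → ℝ → Measure (PhaseSpace M), LimitClause ω₂ lam β γ μ T 1 := by
  intro h
  have h1 := h fun M _ _ => Measure.dirac (junkPoint M)
  unfold LimitClause at h1
  change Tendsto (fun δ : ℝ =>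
      (pinnedChain ω₂ lam β γ).totalCurrent (Measure.dirac (junkPoint 2)) / δ) (𝓝[≠] 0) _ at h1
  simp only [totalCurrent_dirac_junkPoint] at h1
  exact not_tendsto_of_eventuallyEq_const_div (c := -(1 + β)) (by linarith) EventuallyEq.rfl h1

/-- **`0 < T` is load-bearing only through the family hypothesis.** For `T ≤ 0` the two bath
temperatures `T ± δ/2` are never both positive, so `SteadyFamily` says nothing there: re-defining
any steady family (one exists, `pinnedChain_exists_isSteadyState`) as the Dirac junk at
non-positive temperatures keeps it steady and breaks the limit clause at `N = 1`. [folklore] -/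
theorem limitClause_false_without_T_pos {ω₂ lam β γ : ℝ} (hω : 0 < ω₂) (hl : 0 < lam)
    (hβ : 0 < β) (hγ : 0 < γ) {T : ℝ} (hT : T ≤ 0) :
    ∃ μ : (M : ℕ) → ℝ → ℝ → Measure (PhaseSpace M),
      SteadyFamily ω₂ lam β γ μ ∧ ¬ LimitClause ω₂ lam β γ μ T 1 := by
  classical
  choose ν hν using fun (M : ℕ) (a b : ℝ) (ha : 0 < a) (hb : 0 < b) =>
    pinnedChain_exists_isSteadyState hω hl hβ hγ M ha hb
  let μ : (M : ℕ) → ℝ → ℝ → Measure (PhaseSpace M) := fun M a b =>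
    if h : 0 < a ∧ 0 < b then ν M a b h.1 h.2 else Measure.dirac (junkPoint M)
  refine ⟨μ, fun M a b ha hb => ?_, fun hlim => ?_⟩
  · show (pinnedChain ω₂ lam β γ).IsSteadyState M a b
      (if h : 0 < a ∧ 0 < b then ν M a b h.1 h.2 else Measure.dirac (junkPoint M))
    rw [dif_pos ⟨ha, hb⟩]
    exact hν M a b ha hb
  · unfold LimitClause at hlim
    have hev : (fun δ : ℝ => (pinnedChain ω₂ lam β γ).totalCurrent
        (μ (1 + 1) (T + δ / 2) (T - δ / 2)) / δ) = fun δ => (-(1 + β)) / δ := by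
      funext δ
      have hnot : ¬ (0 < T + δ / 2 ∧ 0 < T - δ / 2) := fun h => by linarith [h.1, h.2]
      show (pinnedChain ω₂ lam β γ).totalCurrent
          (if h : 0 < T + δ / 2 ∧ 0 < T - δ / 2 then ν 2 (T + δ / 2) (T - δ / 2) h.1 h.2
            else Measure.dirac (junkPoint 2)) / δ = _
      rw [dif_neg hnot, totalCurrent_dirac_junkPoint]
    rw [hev] at hlim
    exact not_tendsto_of_eventuallyEq_const_div (c := -(1 + β)) (by linarith) EventuallyEq.rfl hlim

/-! ### §3 What a refutation must contain -/

/-- **Shape of any refutation.** `¬ BoundaryKubo` holds iff at some admissible parameter point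
weak-NESS uniqueness (`UniqueSteady`, the open item stmt-0741 there) HOLDS and some steady family
breaks the integrability or the limit clause at some `T > 0`, `N`. In particular no refutation can
be landed without a proof of stmt-0741 at a parameter point. [folklore] -/
theorem not_boundaryKubo_iff :
    ¬ BoundaryKubo ↔ ∃ ω₂ lam β γ : ℝ, 0 < ω₂ ∧ 0 < lam ∧ 0 < β ∧ 0 < γ ∧
      UniqueSteady ω₂ lam β γ ∧
        ∃ μ : (M : ℕ) → ℝ → ℝ → Measure (PhaseSpace M), SteadyFamily ω₂ lam β γ μ ∧
          ∃ T : ℝ, 0 < T ∧ ∃ N : ℕ,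
            ¬ (IntegrableOn (kuboIntegrand ω₂ lam β γ T N) (Ioi 0) ∧
                LimitClause ω₂ lam β γ μ T N) := by
  rw [boundaryKubo_iff]
  push Not
  rfl

/-! ### §4 Reformulation: the crux is differentiability of the steady current at `δ = 0` -/

/-- Under uniqueness, the member of a steady family at equal temperatures IS the Gibbs state
(`pinnedChain_isSteadyState_gibbsMeasure`). [folklore] -/
theorem steadyFamily_apply_self {ω₂ lam β γ : ℝ} (hω : 0 < ω₂) (hl : 0 < lam) (hβ : 0 < β)
    (hU : UniqueSteady ω₂ lam β γ) {μ : (M : ℕ) → ℝ → ℝ → Measure (PhaseSpace M)}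
    (hμ : SteadyFamily ω₂ lam β γ μ) {T : ℝ} (hT : 0 < T) (M : ℕ) :
    μ M T T = (pinnedChain ω₂ lam β γ).gibbsMeasure M T :=
  hU M T T hT hT _ _ (hμ M T T hT hT) (pinnedChain_isSteadyState_gibbsMeasure hω hl.le hβ.le γ M hT)

/-- … so at `δ = 0` the steady current of the family vanishes (no current at equilibrium,
`pinnedChain_totalCurrent_gibbsMeasure`). [folklore] -/
theorem totalCurrent_apply_self {ω₂ lam β γ : ℝ} (hω : 0 < ω₂) (hl : 0 < lam) (hβ : 0 < β)
    (hU : UniqueSteady ω₂ lam β γ) {μ : (M : ℕ) → ℝ → ℝ → Measure (PhaseSpace M)}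
    (hμ : SteadyFamily ω₂ lam β γ μ) {T : ℝ} (hT : 0 < T) (M : ℕ) :
    (pinnedChain ω₂ lam β γ).totalCurrent (μ M T T) = 0 := by
  rw [steadyFamily_apply_self hω hl hβ hU hμ hT M]
  exact pinnedChain_totalCurrent_gibbsMeasure ω₂ lam β γ M T

/-- **The limit clause is exactly a derivative at `δ = 0`.** Under the hypotheses of the crux
(uniqueness, steady family, `T > 0`), `LimitClause` at `(T, N)` holds iff the steady total current
along the symmetric protocol `δ ↦ totalCurrent(μ (N+1) (T+δ/2) (T-δ/2))` (which vanishes at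
`δ = 0`) has derivative `N·(γ²/T²)·∫₀^∞ C_N` at `0`. [folklore] -/
theorem limitClause_iff_hasDerivAt {ω₂ lam β γ : ℝ} (hω : 0 < ω₂) (hl : 0 < lam) (hβ : 0 < β)
    (hU : UniqueSteady ω₂ lam β γ) {μ : (M : ℕ) → ℝ → ℝ → Measure (PhaseSpace M)}
    (hμ : SteadyFamily ω₂ lam β γ μ) {T : ℝ} (hT : 0 < T) (N : ℕ) :
    LimitClause ω₂ lam β γ μ T N ↔
      HasDerivAt (fun δ : ℝ =>
          (pinnedChain ω₂ lam β γ).totalCurrent (μ (N + 1) (T + δ / 2) (T - δ / 2)))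
        (kuboValue ω₂ lam β γ T N) 0 := by
  rw [hasDerivAt_iff_tendsto_slope_zero, LimitClause]
  have h0 : (pinnedChain ω₂ lam β γ).totalCurrent (μ (N + 1) (T + 0 / 2) (T - 0 / 2)) = 0 := by
    rw [zero_div, add_zero, sub_zero]
    exact totalCurrent_apply_self hω hl hβ hU hμ hT (N + 1)
  have hfun : (fun t : ℝ => t⁻¹ • ((pinnedChain ω₂ lam β γ).totalCurrent
        (μ (N + 1) (T + (0 + t) / 2) (T - (0 + t) / 2)) -
        (pinnedChain ω₂ lam β γ).totalCurrent (μ (N + 1) (T + 0 / 2) (T - 0 / 2)))) =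
      fun δ : ℝ => (pinnedChain ω₂ lam β γ).totalCurrent (μ (N + 1) (T + δ / 2) (T - δ / 2)) / δ := by
    funext t
    rw [h0, sub_zero, zero_add, smul_eq_mul, inv_mul_eq_div]
  rw [hfun]

/-! ### §5 `γ = 0`: the crux is vacuous on the isolated chain — `0 < γ` hides behind uniqueness -/

/-- At `γ = 0` the bath temperatures drop out of the generator. [folklore] -/
theorem generator_gamma_zero (ω₂ lam β : ℝ) (N : ℕ) (a b a' b' : ℝ) (f : PhaseSpace N → ℝ)
    (x : PhaseSpace N) :
    (pinnedChain ω₂ lam β 0).generator N a b f x =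
      (pinnedChain ω₂ lam β 0).generator N a' b' f x := by
  simp [OscillatorChain.generator, pinnedChain]

/-- … so at `γ = 0` the weak steady-state class is temperature-blind. [folklore] -/
theorem isSteadyState_gamma_zero_iff (ω₂ lam β : ℝ) (N : ℕ) (a b a' b' : ℝ)
    (μ : Measure (PhaseSpace N)) :
    (pinnedChain ω₂ lam β 0).IsSteadyState N a b μ ↔
      (pinnedChain ω₂ lam β 0).IsSteadyState N a' b' μ := by
  unfold OscillatorChain.IsSteadyState
  simp_rw [generator_gamma_zero ω₂ lam β N a b a' b']

/-- **Weak-NESS uniqueness FAILS at `γ = 0`** (`ω₂ > 0`, `lam, β ≥ 0`) — the landed negative lemma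
`pinnedChain_not_unique_gamma_zero` (Dirac mass at rest vs Gibbs state, crux 11749), in this file's
vocabulary. [folklore] -/
theorem not_uniqueSteady_gamma_zero {ω₂ lam β : ℝ} (hω : 0 < ω₂) (hl : 0 ≤ lam) (hβ : 0 ≤ β) :
    ¬ UniqueSteady ω₂ lam β 0 :=
  pinnedChain_not_unique_gamma_zero hω hl hβ

/-- **The body of the crux is vacuous at `γ = 0`**: there the uniqueness antecedent fails, so
`0 < γ` could be weakened to `0 ≤ γ` without changing the statement — although physically `γ > 0`
is essential (isolated chain: `C_N` does not decay, the integrability clause is false; not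
formalised). Moral: `γ > 0` enters a proof of the crux only through uniqueness / mixing, never
through the algebra of the identity. [folklore] -/
theorem body_vacuous_gamma_zero {ω₂ lam β : ℝ} (hω : 0 < ω₂) (hl : 0 ≤ lam) (hβ : 0 ≤ β) :
    UniqueSteady ω₂ lam β 0 →
      ∀ μ : (M : ℕ) → ℝ → ℝ → Measure (PhaseSpace M), SteadyFamily ω₂ lam β 0 μ →
        ∀ T : ℝ, 0 < T → ∀ N : ℕ,
          IntegrableOn (kuboIntegrand ω₂ lam β 0 T N) (Ioi 0) ∧ LimitClause ω₂ lam β 0 μ T N :=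
  fun hU => absurd hU (not_uniqueSteady_gamma_zero hω hl hβ)

end Summit.AtomisticToContinuum.FouriersLaw.Theorems.BoundaryKubo.Negative.LoadBearing
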